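import Summits.Ventures.HodgeRepro2.HeckeRepIndependence
import Summits.Ventures.HodgeRepro2.HeckeSlashNormalizer

/-!
# Composition of Hecke operators with a normalising element: `T_α ∘ T_β = T_{βα}`

If `β ∈ U(H)(K)` normalises `S`, its Hecke operator is the single slash `T_β f = f ∥_k β`
(`hecke_eq_slash_of_normalizes`), `S β α S = β (S α S)` is the union of the right cosets
`S β α r_q` over the same index set as `S α S` (`heckeSubgroup S (β α) = heckeSubgroup S α`), and
therefore `T_α (T_β f) = T_{β α} f` on the ball.  Consequently the self-adjoint operators attached
to the unitary reflections `r_v = g w` (a torus element `g` times a lattice-stabilising involution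
`w`, cf. `AntidiagonalReflectionFamily.lean`) are the classical operators `T_g` twisted by the
Atkin–Lehner-type involution `T_w`: `T_{g w} = T_{w} ∘ T_{g}`... precisely `T_g ∘ T_w = T_{w g}`.
-/

namespace Summit.Ventures.HodgeRepro2.ShimuraData

open Matrix

variable {K : Type*} [Field K]

/-- The stabiliser subgroup of `β α` is that of `α` when `β` normalises `S`:
`S ∩ (βα)⁻¹ S (βα) = S ∩ α⁻¹ S α`. -/
theorem heckeSubgroup_mul_left_of_normalizes {S : Subgroup (GL (Fin 3) K)} {β α : GL (Fin 3) K}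
    (hβ : ∀ s : GL (Fin 3) K, s ∈ S ↔ β * s * β⁻¹ ∈ S) :
    heckeSubgroup S (β * α) = heckeSubgroup S α := by
  ext s
  simp only [heckeSubgroup, Subgroup.mem_inf, Subgroup.mem_comap, MulEquiv.coe_toMonoidHom,
    MulAut.conj_apply]
  have key : β * α * s * (β * α)⁻¹ = β * (α * s * α⁻¹) * β⁻¹ := by group
  rw [key, ← hβ]

variable [NumberField K] [NumberField.IsCMField K] {τ₁ : K →+* ℂ} {H : Matrix (Fin 3) (Fin 3) K}
  {Q : Matrix (Fin 3) (Fin 3) ℂ}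

/-- **`T_α ∘ T_β = T_{β α}` for `β` normalising `S`** (on the ball, for weight-`k` forms for `S`). -/
theorem hecke_hecke_eq_hecke_mul_of_normalizes (hQ : IsFrame K τ₁ H Q) {S : Subgroup (GL (Fin 3) K)}
    (hS : (S : Set (GL (Fin 3) K)) ⊆ (unitaryGroup K H : Set (GL (Fin 3) K)))
    {β α : GL (Fin 3) K} (hβ : ∀ s : GL (Fin 3) K, s ∈ S ↔ β * s * β⁻¹ ∈ S)
    (hβU : β ∈ unitaryGroup K H) (hαU : α ∈ unitaryGroup K H)
    [Fintype (S ⧸ (heckeSubgroup S α).subgroupOf S)]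
    [Fintype (S ⧸ (heckeSubgroup S β).subgroupOf S)]
    [Fintype (S ⧸ (heckeSubgroup S (β * α)).subgroupOf S)]
    {k : ℕ} {f : (Fin 2 → ℂ) → ℂ} (hf : IsWeightFor τ₁ Q S k f) {z : Fin 2 → ℂ} (hz : z ∈ ball₂) :
    hecke S α τ₁ Q k (hecke S β τ₁ Q k f) z = hecke S (β * α) τ₁ Q k f z := by
  have hT : ∀ w ∈ ball₂, hecke S β τ₁ Q k f w = slash k (realEmbedding K τ₁ Q β) f w :=
    fun w hw => hecke_eq_slash_of_normalizes hQ hS hβ hβU hf hw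
  -- the left-hand side, term by term
  have hL : ∀ q : S ⧸ (heckeSubgroup S α).subgroupOf S,
      slash k (realEmbedding K τ₁ Q (α * heckeRep S α q)) (hecke S β τ₁ Q k f) z =
        slash k (realEmbedding K τ₁ Q (β * (α * heckeRep S α q))) f z := by
    intro q
    have hU : α * heckeRep S α q ∈ unitaryGroup K H :=
      (unitaryGroup K H).mul_mem hαU (hS (heckeRep S α q).property)
    have hA : IsInU21 (realEmbedding K τ₁ Q (α * heckeRep S α q)) := hQ.isInU21_realEmbedding hU
    rw [hQ.realEmbedding_mul β (α * heckeRep S α q), slash_mul k hA f hz]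
    show (autFactor _ z ^ k)⁻¹ * hecke S β τ₁ Q k f (ballAction _ z) =
      (autFactor _ z ^ k)⁻¹ * slash k (realEmbedding K τ₁ Q β) f (ballAction _ z)
    rw [hT _ (hA.ballAction_mem_ball₂ hz)]
  have hsub : (heckeSubgroup S α).subgroupOf S = (heckeSubgroup S (β * α)).subgroupOf S := by
    rw [heckeSubgroup_mul_left_of_normalizes hβ]
  let e : (S ⧸ (heckeSubgroup S α).subgroupOf S) ≃ (S ⧸ (heckeSubgroup S (β * α)).subgroupOf S) :=
    Subgroup.quotientEquivOfEq hsub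
  show ∑ q, slash k (realEmbedding K τ₁ Q (α * heckeRep S α q)) (hecke S β τ₁ Q k f) z =
    ∑ q', slash k (realEmbedding K τ₁ Q (β * α * heckeRep S (β * α) q')) f z
  refine Fintype.sum_equiv e _ _ fun q => ?_
  rw [hL q]
  -- the two representatives lie in the same right coset
  have hmk : (QuotientGroup.mk (Quotient.out (e q)) : S ⧸ (heckeSubgroup S (β * α)).subgroupOf S) =
      QuotientGroup.mk (Quotient.out q) := by
    rw [QuotientGroup.out_eq']
    show e q = QuotientGroup.mk (Quotient.out q)
    rw [← Subgroup.quotientEquivOfEq_mk hsub, QuotientGroup.out_eq']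
  have hu : (Quotient.out (e q))⁻¹ * Quotient.out q ∈ (heckeSubgroup S (β * α)).subgroupOf S :=
    QuotientGroup.eq.mp hmk
  rw [Subgroup.mem_subgroupOf] at hu
  -- hu : ↑((out (e q))⁻¹ * out q) ∈ heckeSubgroup S (β * α)
  have hconj : β * α * ((Quotient.out (e q))⁻¹ * Quotient.out q : S) * (β * α)⁻¹ ∈ S := by
    have := (Subgroup.mem_inf.mp hu).2
    simpa only [Subgroup.mem_comap, MulEquiv.coe_toMonoidHom, MulAut.conj_apply] using this
  -- β α (out q)⁻¹ = (β α u (βα)⁻¹) · (β α (out (e q))⁻¹) with u = (out (e q))⁻¹ out q ... inverted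
  have hrel : β * (α * heckeRep S α q) =
      (β * α * ((Quotient.out q)⁻¹ * Quotient.out (e q) : S) * (β * α)⁻¹) *
        (β * α * heckeRep S (β * α) (e q)) := by
    unfold heckeRep
    simp only [Subgroup.coe_mul, Subgroup.coe_inv]
    group
  have hγ : β * α * ((Quotient.out q)⁻¹ * Quotient.out (e q) : S) * (β * α)⁻¹ ∈ S := by
    have h' := S.inv_mem hconj
    have heq : (β * α * ((Quotient.out (e q))⁻¹ * Quotient.out q : S) * (β * α)⁻¹)⁻¹ =
        β * α * ((Quotient.out q)⁻¹ * Quotient.out (e q) : S) * (β * α)⁻¹ := by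
      simp only [Subgroup.coe_mul, Subgroup.coe_inv]
      group
    rwa [heq] at h'
  rw [hrel, slash_realEmbedding_mul_left hQ hS hf hγ
    ((unitaryGroup K H).mul_mem ((unitaryGroup K H).mul_mem hβU hαU)
      (hS (heckeRep S (β * α) (e q)).property)) hz]

end Summit.Ventures.HodgeRepro2.ShimuraData
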